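import Summits.ResolutionOfSingularities.ResolutionOfSingularities.Theorems.EquisingularLiftEquisingularLiftNatF102CoordinatesOfIso
import Literature.AlgebraicGeometry.Modules.KernelFiniteLocallyFree
import Mathlib.AlgebraicGeometry.IdealSheaf.Basic
import Mathlib.AlgebraicGeometry.Morphisms.ClosedImmersion
import Mathlib.AlgebraicGeometry.Properties
import HarnessLib

/-!
# [OURS · L1 W4.5(b) · LINE (T-j)-PROOF · BRICK B4 (γ*), pieces (P1)(P3)(P4)] The ideal of a `K`-point on affine opens

Crux chain w45b (cell `res-hironaka`), EL♮(3) stmt-ResolutionOfSingularities-20148, LINE (T-j)-PROOF of F-102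
`Literature.AlgebraicGeometry.Resolution.GenusZeroOverCompleteDVR` (res-L1-w45b-lead-2 g3, skeleton v3 1683bb741349c142), BRICK B4, special-fibre
triviality (γ*): the three point-ideal statements of res-L1-w45b-lead-2's `L/res-L1-w45b-lead-2/F102-PointIdeal.sig.lean` VERBATIM (SUB-DEAL
2026-08-27T22:46:09Z/22:46:20Z; first arrival res-L1-type-o6 g30, 22:5xZ), serving (α) (`y = z_j ∈ C_k`, `g = i♯r`) and (γ) (`y = y_j ∈ ℙ¹`,
`g = x_{j'}/x_j`). OURS; NOT a statement of any manuscript; AI-written, weaker than expert review. No `sorry`; standard axioms; DEF-FREE.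
`--supports stmt-ResolutionOfSingularities-20148 --as helper`.

For a field `K`, a morphism `p : Spec K → Y` and an affine open `U` of `Y`:
* `eq_closedPoint_of_field` — `Spec K` has one point.
* **(P1) `ker_ideal_eq_top_of_not_mem`** — if the point `y = p(pt)` is not in `U`, `(ker p)(U) = ⊤` (`p⁻¹U = ∅`).
* **(P3) `ker_ideal_eq_primeIdealOf`** — if `y ∈ U`, `(ker p)(U) = 𝔭_y` (the prime of `y` in `Γ(U)`): `a ∈ ker p♯_U ⇔ p♯(a) = 0 ⇔ (Spec K)_{p♯a} = ∅`
  (`Spec K` reduced) `⇔ y ∉ Y_a` (`p⁻¹ Y_a = (Spec K)_{p♯ a}`, one point) `⇔ a ∈ 𝔭_y`.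
* **(P4) `primeIdealOf_eq_span`** — if `germ_y g` generates `𝔪_y` and `g` is a unit at every other point of `U`, then `𝔭_y = (g)` (Mathlib's
  local criterion `IsAffineOpen.mem_ideal_iff`: at `y` by `hg`, elsewhere `germ g` is a unit).

References: R. Hartshorne, *Algebraic Geometry* (1977), II Ex. 2.7, II Prop. 2.2 [cite: Hartshorne1977]; The Stacks Project, Tag 01J7 [cite: StacksProject].
-/

set_option linter.dupNamespace false -- mandated namespace `Summit.<Summit>.<Problem>` of this single-conjunct summit

noncomputable section

open CategoryTheory AlgebraicGeometry TopologicalSpace Opposite IsLocalRing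
open Literature.AlgebraicGeometry.Modules

namespace Summit.ResolutionOfSingularities.ResolutionOfSingularities.Cruxes.EquisingularLiftNat.F102

universe u

/-- `Spec` of a field has exactly one point. [folklore] -/
theorem eq_closedPoint_of_field {K : Type u} [Field K] (x : Spec (.of K)) : x = closedPoint K := by
  apply PrimeSpectrum.ext
  rw [Ideal.eq_bot_of_prime x.asIdeal]
  exact (Ideal.eq_bot_of_prime (closedPoint K).asIdeal).symm

/-- (P1) **Off the point the ideal of a `K`-point is the unit ideal**: `p : Spec K → Y`, `U` affine with `p(pt) ∉ U` ⇒ `(ker p)(U) = ⊤`.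
[cite: Hartshorne1977, II Ex. 2.7] [OURS · L1 W4.5b · brick B4 (γ*) (P1)] -/
theorem ker_ideal_eq_top_of_not_mem {Y : Scheme.{u}} {K : Type u} [Field K] (p : Spec (.of K) ⟶ Y) [QuasiCompact p]
    (U : Y.affineOpens) (hy : p.base (closedPoint K) ∉ (U : Y.Opens)) : p.ker.ideal U = ⊤ := by
  have hempty : p ⁻¹ᵁ (U : Y.Opens) = ⊥ := by
    ext x
    simp only [Scheme.Hom.coe_preimage, Set.mem_preimage, SetLike.mem_coe, Opens.coe_bot, Set.mem_empty_iff_false, iff_false]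
    rw [eq_closedPoint_of_field x]
    exact hy
  rw [eq_top_iff]
  intro a _
  change a ∈ p.ker.ideal U
  rw [Scheme.Hom.ker_apply, RingHom.mem_ker]
  haveI := subsingleton_sections_preimage_of_eq_bot p (U : Y.Opens) hempty
  exact Subsingleton.elim _ _

/-- On `Spec` of a field, a section vanishes iff its basic open misses the point. [folklore] -/
theorem eq_zero_iff_closedPoint_not_mem_basicOpen {K : Type u} [Field K] {V : (Spec (.of K)).Opens} (s : Γ(Spec (.of K), V)) :
    s = 0 ↔ closedPoint K ∉ (Spec (.of K)).basicOpen s := by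
  rw [← basicOpen_eq_bot_iff]
  constructor
  · intro h hmem
    rw [h] at hmem
    exact hmem
  · intro h
    ext x
    simp only [Opens.coe_bot, Set.mem_empty_iff_false, iff_false]
    rw [eq_closedPoint_of_field x]
    exact h

/-- (P3) **At the point the ideal of a `K`-point is the prime of the point**: `p : Spec K → Y`, `U` affine with `y = p(pt) ∈ U` ⇒
`(ker p)(U) = 𝔭_y ⊆ Γ(Y, U)`. [cite: Hartshorne1977, II Ex. 2.7] [OURS · L1 W4.5b · brick B4 (γ*) (P3)] -/
theorem ker_ideal_eq_primeIdealOf {Y : Scheme.{u}} {K : Type u} [Field K] (p : Spec (.of K) ⟶ Y) [QuasiCompact p]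
    (U : Y.affineOpens) (hy : p.base (closedPoint K) ∈ (U : Y.Opens)) :
    p.ker.ideal U = (U.2.primeIdealOf ⟨p.base (closedPoint K), hy⟩).asIdeal := by
  rw [Scheme.Hom.ker_apply]
  ext a
  rw [RingHom.mem_ker]
  have h1 : a ∈ (U.2.primeIdealOf ⟨p.base (closedPoint K), hy⟩).asIdeal ↔ p.base (closedPoint K) ∉ Y.basicOpen a := by
    rw [mem_basicOpen_iff_not_mem_primeIdealOf U.2 a hy, not_not]
  rw [h1, eq_zero_iff_closedPoint_not_mem_basicOpen]
  change closedPoint K ∉ (Spec (.of K)).basicOpen (p.app (U : Y.Opens) a) ↔ _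
  rw [← Scheme.preimage_basicOpen]
  rfl

/-- (P4) **A local generator of `𝔪_y` which is a unit elsewhere generates `𝔭_y`**: on an affine open `U ∋ y` (`y` closed), if
`germ_y g` generates the maximal ideal of `𝒪_{Y,y}` and every other point of `U` lies in `Y_g`, then `𝔭_y = (g)` in `Γ(Y, U)`
(Mathlib's local criterion for ideal membership on affine opens). [cite: Hartshorne1977, II Prop. 2.2] [OURS · L1 W4.5b · brick B4 (γ*) (P4)] -/
theorem primeIdealOf_eq_span {Y : Scheme.{u}} (U : Y.affineOpens) {y : Y} (hy : y ∈ (U : Y.Opens))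
    (hyc : IsClosed ({y} : Set Y)) (g : Γ(Y, (U : Y.Opens)))
    (hg : Ideal.span {Y.presheaf.germ (U : Y.Opens) y hy g} = maximalIdeal (Y.presheaf.stalk y))
    (hunit : ∀ q ∈ (U : Y.Opens), q ≠ y → q ∈ Y.basicOpen g) :
    (U.2.primeIdealOf ⟨y, hy⟩).asIdeal = Ideal.span {g} := by
  have _hmax := U.2.primeIdealOf_isMaximal_of_isClosed ⟨y, hy⟩ hyc
  apply le_antisymm
  · -- `s ∈ 𝔭_y ⇒ s ∈ (g)`: check at every point of `U`
    intro s hs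
    rw [U.2.mem_ideal_iff]
    intro x hx
    rw [Ideal.map_span, Set.image_singleton]
    by_cases hxy : x = y
    · subst hxy
      rw [hg, IsLocalRing.mem_maximalIdeal, mem_nonunits_iff, ← Scheme.mem_basicOpen]
      exact fun h => (mem_basicOpen_iff_not_mem_primeIdealOf U.2 s hy).mp h hs
    · have hux : IsUnit (Y.presheaf.germ (U : Y.Opens) x hx g) := (Scheme.mem_basicOpen _ _ x hx).mp (hunit x hx hxy)
      rw [Ideal.span_singleton_eq_top.mpr hux]
      trivial
  · rw [Ideal.span_le, Set.singleton_subset_iff, SetLike.mem_coe]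
    have hgy : Y.presheaf.germ (U : Y.Opens) y hy g ∈ maximalIdeal (Y.presheaf.stalk y) := by
      rw [← hg]; exact Ideal.mem_span_singleton_self _
    rw [IsLocalRing.mem_maximalIdeal, mem_nonunits_iff, ← Scheme.mem_basicOpen] at hgy
    exact not_not.mp ((mem_basicOpen_iff_not_mem_primeIdealOf U.2 g hy).not.mp hgy)

end Summit.ResolutionOfSingularities.ResolutionOfSingularities.Cruxes.EquisingularLiftNat.F102

end
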